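import Mathlib
import Summits.PneNP.PneNP.Theorems.Nc03AvoidResidualCoreCandCutNormCertificate

/-!
# The cylinder count of a signed-sum event by a forward dynamic programme — line «sfm-bl»
(MACHINE-PLAN M4: the SPEC of the machine's table for one pair `(W₁, W₂)` of one spot; PROOF-SFM-BL §3)

FRONTIER F-N1c; nothing here bears on P vs NP.

For coefficients `c : Fin m → ℤ` (the leg counts `c_j = #{e ∈ S ∩ W₁×W₂ : out e = j}`), fixed outputs `P` with
values `T₀` and `χ = CandCutNorm.boolSign` (`true ↦ −1`), the machine must output
`#{T ∈ cyl(P,T₀) : θ < (Σ_j c_j χ(T j))²}` (integer threshold, `SfmBlCylinderCounts.filter_bad_real_eq_int`).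
It keeps, for `k = 0, …, m`, the table `v ↦ N_k(v)` on `v ∈ [−Σ|c_j|, Σ|c_j|]`, where
`N_k(v) := #{T : (∀ j, j ∈ P ∨ k ≤ j → T j = T₀ j) ∧ Σ_{j<k} c_j χ(T j) = v}` — the signings still frozen to
`T₀` on the fixed outputs and on the unprocessed window `[k, m)`, counted by the value of the processed partial
sum (written out in every statement; definition-free file):
* `dpCount_zero` — `N_0 = δ_0`;
* `dpCount_succ_of_mem` — fixed output `k ∈ P`: `N_{k+1}(v) = N_k(v − c_k χ(T₀ k))` (a shift);
* `dpCount_succ_of_not_mem` — free output `k ∉ P`: `N_{k+1}(v) = N_k(v − c_k) + N_k(v + c_k)` (a convolution),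
  via the re-freezing bijection `dpCount_succ_half`;
* `dpCount_final` — `N_m(v) = #{T ∈ cyl(P,T₀) : Σ_j c_j χ(T j) = v}`;
* `card_cylinder_filter_eq_sum` — `#{T ∈ cyl : p(Σ)} = Σ_{v ∈ V, p v} N_m(v)` for any finite `V` containing the
  range, and `signSum_mem_Icc` — `V = Icc (−Σ|c_j|) (Σ|c_j|)` does (table size `2Σ|c_j| + 1 ≤ 6·#legs + 1`).
-/

namespace Summit.PneNP.PneNP.Theorems.SfmBl

open Finset BigOperators
open Summit.PneNP.PneNP.Theorems.CandCutNorm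

variable {m : ℕ}

/-! ### Helpers -/

/-- `χ(false) = 1`. -/
theorem boolSign_false_eq : boolSign false = 1 := by simp [boolSign]

/-- `χ(true) = −1`. -/
theorem boolSign_true_eq : boolSign true = -1 := by simp [boolSign]

/-- One more term of a prefix sum over `Fin m`. -/
theorem sum_prefix_succ {M : Type*} [AddCommMonoid M] (f : Fin m → M) {k : ℕ} (hk : k < m) :
    ∑ j ∈ Finset.univ.filter (fun j : Fin m => (j : ℕ) < k + 1), f j
      = ∑ j ∈ Finset.univ.filter (fun j : Fin m => (j : ℕ) < k), f j + f ⟨k, hk⟩ := by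
  have : (Finset.univ.filter fun j : Fin m => (j : ℕ) < k + 1)
      = insert ⟨k, hk⟩ (Finset.univ.filter fun j : Fin m => (j : ℕ) < k) := by
    ext j
    simp only [Finset.mem_filter, Finset.mem_univ, true_and, Finset.mem_insert, Fin.ext_iff]
    omega
  rw [this, Finset.sum_insert (by simp), add_comm]

/-- A prefix sum below `k` does not see an update at `k`. -/
theorem sum_prefix_update {M : Type*} [AddCommMonoid M] (g : Bool → M) (c : Fin m → M → M)
    (T : Fin m → Bool) {k : ℕ} (hk : k < m) (b : Bool) :
    ∑ j ∈ Finset.univ.filter (fun j : Fin m => (j : ℕ) < k), c j (g (Function.update T ⟨k, hk⟩ b j))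
      = ∑ j ∈ Finset.univ.filter (fun j : Fin m => (j : ℕ) < k), c j (g (T j)) := by
  refine Finset.sum_congr rfl fun j hj => ?_
  have hjk : j ≠ ⟨k, hk⟩ := fun e => by
    subst e; exact lt_irrefl _ (Finset.mem_filter.1 hj).2
  rw [Function.update_of_ne hjk]

/-! ### The recursion -/

/-- `N_0(v) = [v = 0]`. -/
theorem dpCount_zero (c : Fin m → ℤ) (P : Finset (Fin m)) (T₀ : Fin m → Bool) (v : ℤ) :
    (Finset.univ.filter fun T : Fin m → Bool =>
        (∀ j : Fin m, (j ∈ P ∨ 0 ≤ (j : ℕ)) → T j = T₀ j) ∧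
          ∑ j ∈ Finset.univ.filter (fun j : Fin m => (j : ℕ) < 0), c j * boolSign (T j) = v).card
      = if v = 0 then 1 else 0 := by
  have hsum : ∀ T : Fin m → Bool,
      ∑ j ∈ Finset.univ.filter (fun j : Fin m => (j : ℕ) < 0), c j * boolSign (T j) = 0 := fun T =>
    Finset.sum_eq_zero fun j hj => absurd (Finset.mem_filter.1 hj).2 (Nat.not_lt_zero _)
  by_cases hv : v = 0
  · rw [if_pos hv, Finset.card_eq_one]
    refine ⟨T₀, ?_⟩
    ext T
    simp only [Finset.mem_filter, Finset.mem_univ, true_and, Finset.mem_singleton]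
    constructor
    · intro h; funext j; exact h.1 j (Or.inr (Nat.zero_le _))
    · rintro rfl; exact ⟨fun j _ => rfl, by rw [hsum, hv]⟩
  · rw [if_neg hv, Finset.card_eq_zero, Finset.filter_eq_empty_iff]
    rintro T - ⟨-, h⟩
    exact hv (by rw [← h, hsum])

/-- FIXED OUTPUT `k ∈ P`: `N_{k+1}(v) = N_k(v − c_k χ(T₀ k))`. -/
theorem dpCount_succ_of_mem (c : Fin m → ℤ) (P : Finset (Fin m)) (T₀ : Fin m → Bool) {k : ℕ}
    (hk : k < m) (hP : (⟨k, hk⟩ : Fin m) ∈ P) (v : ℤ) :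
    (Finset.univ.filter fun T : Fin m → Bool =>
        (∀ j : Fin m, (j ∈ P ∨ k + 1 ≤ (j : ℕ)) → T j = T₀ j) ∧
          ∑ j ∈ Finset.univ.filter (fun j : Fin m => (j : ℕ) < k + 1), c j * boolSign (T j) = v).card
      = (Finset.univ.filter fun T : Fin m → Bool =>
        (∀ j : Fin m, (j ∈ P ∨ k ≤ (j : ℕ)) → T j = T₀ j) ∧
          ∑ j ∈ Finset.univ.filter (fun j : Fin m => (j : ℕ) < k), c j * boolSign (T j)
            = v - c ⟨k, hk⟩ * boolSign (T₀ ⟨k, hk⟩)).card := by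
  congr 1
  refine Finset.filter_congr fun T _ => ?_
  -- the two agreement conditions coincide because `k ∈ P`
  have hagree : (∀ j : Fin m, (j ∈ P ∨ k + 1 ≤ (j : ℕ)) → T j = T₀ j)
      ↔ (∀ j : Fin m, (j ∈ P ∨ k ≤ (j : ℕ)) → T j = T₀ j) := by
    constructor
    · intro h j hj
      rcases hj with hj | hj
      · exact h j (Or.inl hj)
      · by_cases hjk : (j : ℕ) = k
        · have : j = ⟨k, hk⟩ := Fin.ext hjk
          rw [this]; exact h _ (Or.inl hP)
        · exact h j (Or.inr (by omega))
    · intro h j hj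
      exact h j (hj.imp_right fun h' => by omega)
  rw [hagree]
  refine and_congr_right fun h => ?_
  rw [sum_prefix_succ _ hk, h ⟨k, hk⟩ (Or.inl hP)]
  constructor
  · intro e; rw [← e]; ring
  · intro e; rw [e]; ring

/-- The two halves of the free step: signings of `N_{k+1}(v)` with `T k = b` correspond, by re-freezing
output `k`, to `N_k(v − c_k χ(b))`. -/
theorem dpCount_succ_half (c : Fin m → ℤ) (P : Finset (Fin m)) (T₀ : Fin m → Bool) {k : ℕ}
    (hk : k < m) (hP : (⟨k, hk⟩ : Fin m) ∉ P) (v : ℤ) (b : Bool) :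
    (Finset.univ.filter fun T : Fin m → Bool =>
        ((∀ j : Fin m, (j ∈ P ∨ k + 1 ≤ (j : ℕ)) → T j = T₀ j) ∧
          ∑ j ∈ Finset.univ.filter (fun j : Fin m => (j : ℕ) < k + 1), c j * boolSign (T j) = v) ∧
          T ⟨k, hk⟩ = b).card
      = (Finset.univ.filter fun T : Fin m → Bool =>
        (∀ j : Fin m, (j ∈ P ∨ k ≤ (j : ℕ)) → T j = T₀ j) ∧
          ∑ j ∈ Finset.univ.filter (fun j : Fin m => (j : ℕ) < k), c j * boolSign (T j)
            = v - c ⟨k, hk⟩ * boolSign b).card := by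
  refine Finset.card_bij' (fun T _ => Function.update T ⟨k, hk⟩ (T₀ ⟨k, hk⟩))
    (fun T _ => Function.update T ⟨k, hk⟩ b) ?_ ?_ ?_ ?_
  · -- maps into
    rintro T hT
    simp only [Finset.mem_filter, Finset.mem_univ, true_and] at hT ⊢
    obtain ⟨⟨hagree, hsum⟩, hTk⟩ := hT
    refine ⟨fun j hj => ?_, ?_⟩
    · by_cases hjk : j = ⟨k, hk⟩
      · subst hjk; rw [Function.update_self]
      · rw [Function.update_of_ne hjk]
        have hne : (j : ℕ) ≠ k := fun e => hjk (Fin.ext e)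
        exact hagree j (hj.imp_right fun h' => by omega)
    · rw [sum_prefix_update (fun x => boolSign x) (fun j s => c j * s) T hk]
      rw [sum_prefix_succ _ hk, hTk] at hsum
      rw [← hsum]; ring
  · -- maps back
    rintro T hT
    simp only [Finset.mem_filter, Finset.mem_univ, true_and] at hT ⊢
    obtain ⟨hagree, hsum⟩ := hT
    refine ⟨⟨fun j hj => ?_, ?_⟩, by rw [Function.update_self]⟩
    · have hjk : j ≠ ⟨k, hk⟩ := by
        rintro rfl
        rcases hj with hj | hj
        · exact hP hj
        · exact absurd hj (by simp)
      rw [Function.update_of_ne hjk]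
      exact hagree j (hj.imp_right fun h' => by omega)
    · rw [sum_prefix_succ _ hk, sum_prefix_update (fun x => boolSign x) (fun j s => c j * s) T hk,
        Function.update_self, hsum]
      ring
  · -- left inverse
    rintro T hT
    simp only [Finset.mem_filter, Finset.mem_univ, true_and] at hT
    rw [Function.update_idem, ← hT.2, Function.update_eq_self]
  · -- right inverse
    rintro T hT
    simp only [Finset.mem_filter, Finset.mem_univ, true_and] at hT
    rw [Function.update_idem, ← hT.1 ⟨k, hk⟩ (Or.inr le_rfl), Function.update_eq_self]

/-- FREE OUTPUT `k ∉ P`: `N_{k+1}(v) = N_k(v − c_k) + N_k(v + c_k)` (`T k = false` contributes `+c_k`,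
`T k = true` contributes `−c_k`). -/
theorem dpCount_succ_of_not_mem (c : Fin m → ℤ) (P : Finset (Fin m)) (T₀ : Fin m → Bool) {k : ℕ}
    (hk : k < m) (hP : (⟨k, hk⟩ : Fin m) ∉ P) (v : ℤ) :
    (Finset.univ.filter fun T : Fin m → Bool =>
        (∀ j : Fin m, (j ∈ P ∨ k + 1 ≤ (j : ℕ)) → T j = T₀ j) ∧
          ∑ j ∈ Finset.univ.filter (fun j : Fin m => (j : ℕ) < k + 1), c j * boolSign (T j) = v).card
      = (Finset.univ.filter fun T : Fin m → Bool =>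
          (∀ j : Fin m, (j ∈ P ∨ k ≤ (j : ℕ)) → T j = T₀ j) ∧
            ∑ j ∈ Finset.univ.filter (fun j : Fin m => (j : ℕ) < k), c j * boolSign (T j)
              = v - c ⟨k, hk⟩).card
        + (Finset.univ.filter fun T : Fin m → Bool =>
          (∀ j : Fin m, (j ∈ P ∨ k ≤ (j : ℕ)) → T j = T₀ j) ∧
            ∑ j ∈ Finset.univ.filter (fun j : Fin m => (j : ℕ) < k), c j * boolSign (T j)
              = v + c ⟨k, hk⟩).card := by
  rw [← Finset.card_filter_add_card_filter_not (fun T : Fin m → Bool => T ⟨k, hk⟩ = false),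
    Finset.filter_filter, Finset.filter_filter]
  have h1 := dpCount_succ_half c P T₀ hk hP v false
  have h2 := dpCount_succ_half c P T₀ hk hP v true
  rw [boolSign_false_eq, mul_one] at h1
  rw [boolSign_true_eq, mul_neg, mul_one, sub_neg_eq_add] at h2
  rw [h1]
  congr 1
  rw [← h2]
  congr 1
  refine Finset.filter_congr fun T _ => ?_
  rw [Bool.not_eq_false]

/-- LAST STEP `k = m`: `N_m(v) = #{T ∈ cyl(P,T₀) : Σ_j c_j χ(T j) = v}`. -/
theorem dpCount_final (c : Fin m → ℤ) (P : Finset (Fin m)) (T₀ : Fin m → Bool) (v : ℤ) :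
    (Finset.univ.filter fun T : Fin m → Bool =>
        (∀ j : Fin m, (j ∈ P ∨ m ≤ (j : ℕ)) → T j = T₀ j) ∧
          ∑ j ∈ Finset.univ.filter (fun j : Fin m => (j : ℕ) < m), c j * boolSign (T j) = v)
      = Finset.univ.filter fun T : Fin m → Bool =>
          (∀ i ∈ P, T i = T₀ i) ∧ ∑ j, c j * boolSign (T j) = v := by
  have hf : (Finset.univ.filter fun j : Fin m => (j : ℕ) < m) = Finset.univ :=
    Finset.filter_true_of_mem fun j _ => j.isLt
  refine Finset.filter_congr fun T _ => ?_
  rw [hf]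
  refine and_congr_left fun _ => ⟨fun h i hi => h i (Or.inl hi), fun h j hj => ?_⟩
  rcases hj with hj | hj
  · exact h j hj
  · exact absurd j.isLt (not_lt.2 hj)

/-- LAYER CAKE: for a decidable event `p` on the value and any finite `V` containing every value of the
signed sum on the cylinder, `#{T ∈ cyl : p(Σ_j c_j χ(T j))} = Σ_{v ∈ V, p v} #{T ∈ cyl : Σ = v}`. -/
theorem card_cylinder_filter_eq_sum (c : Fin m → ℤ) (P : Finset (Fin m)) (T₀ : Fin m → Bool)
    (p : ℤ → Prop) [DecidablePred p] (V : Finset ℤ)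
    (hV : ∀ T : Fin m → Bool, (∀ i ∈ P, T i = T₀ i) → ∑ j, c j * boolSign (T j) ∈ V) :
    (Finset.univ.filter fun T : Fin m → Bool =>
        (∀ i ∈ P, T i = T₀ i) ∧ p (∑ j, c j * boolSign (T j))).card
      = ∑ v ∈ V.filter p, (Finset.univ.filter fun T : Fin m → Bool =>
          (∀ i ∈ P, T i = T₀ i) ∧ ∑ j, c j * boolSign (T j) = v).card := by
  have H : Set.MapsTo (fun T : Fin m → Bool => ∑ j, c j * boolSign (T j))
      ((Finset.univ.filter fun T : Fin m → Bool =>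
        (∀ i ∈ P, T i = T₀ i) ∧ p (∑ j, c j * boolSign (T j))) : Finset (Fin m → Bool))
      (V.filter p : Finset ℤ) := by
    intro T hT
    have hT' := Finset.mem_filter.1 (Finset.mem_coe.1 hT)
    exact Finset.mem_coe.2 (Finset.mem_filter.2 ⟨hV T hT'.2.1, hT'.2.2⟩)
  rw [Finset.card_eq_sum_card_fiberwise H]
  refine Finset.sum_congr rfl fun v hv => ?_
  have hpv : p v := (Finset.mem_filter.1 hv).2
  congr 1
  rw [Finset.filter_filter]
  refine Finset.filter_congr fun T _ => ⟨fun h => ⟨h.1.1, h.2⟩, fun h => ⟨⟨h.1, ?_⟩, h.2⟩⟩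
  rw [h.2]; exact hpv

/-- RANGE of the signed sum: `|Σ_j c_j χ(T j)| ≤ Σ_j |c_j|`. -/
theorem abs_signSum_le (c : Fin m → ℤ) (T : Fin m → Bool) :
    |∑ j, c j * boolSign (T j)| ≤ ∑ j, |c j| := by
  refine (Finset.abs_sum_le_sum_abs _ _).trans (Finset.sum_le_sum fun j _ => ?_)
  rw [abs_mul]
  rcases boolSign_eq_one_or (T j) with h | h <;> simp [h]

/-- Hence `V = Icc (−Σ|c_j|) (Σ|c_j|)` is an admissible value table for `card_cylinder_filter_eq_sum`. -/
theorem signSum_mem_Icc (c : Fin m → ℤ) (T : Fin m → Bool) :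
    ∑ j, c j * boolSign (T j) ∈ Finset.Icc (-∑ j, |c j|) (∑ j, |c j|) := by
  rw [Finset.mem_Icc]
  exact abs_le.1 (abs_signSum_le c T)

end Summit.PneNP.PneNP.Theorems.SfmBl
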